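import Summits.QuantumFields.YangMills.Theorems.BalabanLadderIRTwistedSlabFlatHolonomies
import HarnessLib

/-!
# Gauge transformations and ladder configurations on the `Fin` slab (vocabulary of the classical-vacuum classification)

HELPER toward stub **T1** `TwistedSlabAnchor` (LINE `twisted-slab-continuity`, crux `IRcof` stmt-QuantumFields-26930, census row 43;
LEAD prover ym-ir-line-tsc-p1 g2; `--supports` the crux, `--as helper`).  First file of next-seat-plan item (1) of the HOME HANDOFF
(«Fin-box gauge transformations + axial gauge ⇒ classification of twisted-flat configurations of the `(z,1)` slab»): the vocabulary.

For ANY group `G` and the anisotropic `Fin` boxes `n₀ × n₁ × n₂ × n₃` of the line's currency (`FinTorusSite`, `finTorusPlaquette`,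
`tHooftTwistTensor`):
* `gaugeAct g U` — the lattice gauge transformation `U(x,μ) ↦ g(x) · U(x,μ) · g(x+e_μ)⁻¹` of a link configuration; it is a left action
  (`gaugeAct_one'`, `gaugeAct_mul`), conjugates plaquette holonomies at their base point (`finTorusPlaquette_gaugeAct`, via
  `FinTorusSite.shift_comm`) and therefore preserves twisted-flatness for every CENTRE-valued 't Hooft tensor (`twistedFlat_gaugeAct_iff`)
  and every twisted plaquette trace (`trace_twist_mul_finTorusPlaquette_gaugeAct`);
* `ladderConfig Γ` — the LADDER of a quadruple `Γ : Fin 4 → G`: `Γ μ` on the sheet `x_μ = 0` of `μ`-links, `1` elsewhere (the configuration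
  written inline in `ladder_twistedFlat` ∕ `ladder_central_twistedFlat` of the previous files); its plaquette holonomy is the commutator
  `Γ_μ Γ_ν Γ_μ⁻¹ Γ_ν⁻¹` on the stack `x_μ = x_ν = 0` and `1` elsewhere (`finTorusPlaquette_ladderConfig`), so it is twisted-flat for
  `tHooftTwistTensor w` iff `w μ ν · Γ_μ Γ_ν Γ_μ⁻¹ Γ_ν⁻¹ = 1` for `μ < ν` (`ladderConfig_twistedFlat_iff`: the quadruple EATS the twist);
* constant gauge maps act on ladders by simultaneous conjugation (`gaugeAct_const_ladderConfig`).
The sheet-adapted axial gauge and the classification («every twisted-flat configuration is a gauge transform of a ladder») are the next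
file (`…TwistedSlabFlatClassification`).

HONEST FRAMING: lattice group algebra on one box (the zero-action set of the twisted Wilson weight, i.e. the critical manifold a
`β → ∞` analysis of T1 starts from); nothing here is an estimate; nothing bears on `IRcof`, `IR`, or the Yang–Mills mass gap
(Clay: NOT proved); R4 = `BalabanLadder.UV` only.  References: 't Hooft, Nucl. Phys. B153 (1979) §3; González-Arroyo, hep-th/9807108
§4.2; García Pérez–González-Arroyo–Okawa, IJMPA 29 (2014) §2; Creutz, Phys. Rev. D15 (1977) 1128 (axial gauge).
-/

set_option autoImplicit false

open Literature.MathematicalPhysics.QuantumFieldTheory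

namespace Summit.QuantumFields.YangMills.Cruxes.IRcof.TwistedSlab

variable {G : Type*} [Group G] {n₀ n₁ n₂ n₃ : ℕ}

/-! ## §1 Shifts commute; coordinates of shifted sites -/

/-- The periodic shifts of the `Fin` box in two directions commute. [folklore] -/
theorem FinTorusSite.shift_comm (x : FinTorusSite n₀ n₁ n₂ n₃) (μ ν : Fin 4) :
    (x.shift μ).shift ν = (x.shift ν).shift μ := by
  obtain ⟨a, b, c, d⟩ := x
  fin_cases μ <;> fin_cases ν <;> rfl

/-- Shifting in direction `μ` does not change the other coordinates. [folklore] -/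
theorem finTorusSiteCoord_shift_of_ne (x : FinTorusSite n₀ n₁ n₂ n₃) {μ ν : Fin 4} (h : ν ≠ μ) :
    finTorusSiteCoord (x.shift μ) ν = finTorusSiteCoord x ν := by
  obtain ⟨a, b, c, d⟩ := x
  fin_cases μ <;> fin_cases ν <;> first | exact absurd rfl h | rfl

/-! ## §2 Gauge transformations -/

/-- **Lattice gauge transformation** of a link configuration of the `Fin` box by a site map `g`:
`(g • U)(x, μ) = g(x) · U(x, μ) · g(x + e_μ)⁻¹`. [folklore] -/
def gaugeAct (g : FinTorusSite n₀ n₁ n₂ n₃ → G) (U : FinTorusSite n₀ n₁ n₂ n₃ × Fin 4 → G) :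
    FinTorusSite n₀ n₁ n₂ n₃ × Fin 4 → G :=
  fun e => g e.1 * U e * (g (e.1.shift e.2))⁻¹

/-- Unfolding lemma. [folklore] -/
theorem gaugeAct_apply (g : FinTorusSite n₀ n₁ n₂ n₃ → G) (U : FinTorusSite n₀ n₁ n₂ n₃ × Fin 4 → G)
    (x : FinTorusSite n₀ n₁ n₂ n₃) (μ : Fin 4) : gaugeAct g U (x, μ) = g x * U (x, μ) * (g (x.shift μ))⁻¹ := rfl

/-- The trivial gauge map acts trivially. [folklore] -/
theorem gaugeAct_one' (U : FinTorusSite n₀ n₁ n₂ n₃ × Fin 4 → G) : gaugeAct (fun _ => (1 : G)) U = U := by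
  funext e; simp [gaugeAct]

/-- Gauge transformations compose: `(g·h) • U = g • (h • U)`. [folklore] -/
theorem gaugeAct_mul (g h : FinTorusSite n₀ n₁ n₂ n₃ → G) (U : FinTorusSite n₀ n₁ n₂ n₃ × Fin 4 → G) :
    gaugeAct (g * h) U = gaugeAct g (gaugeAct h U) := by
  funext e; simp [gaugeAct, mul_assoc]

/-- `g⁻¹ • (g • U) = U`. [folklore] -/
theorem gaugeAct_inv_gaugeAct (g : FinTorusSite n₀ n₁ n₂ n₃ → G) (U : FinTorusSite n₀ n₁ n₂ n₃ × Fin 4 → G) :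
    gaugeAct g⁻¹ (gaugeAct g U) = U := by
  rw [← gaugeAct_mul, inv_mul_cancel]; exact gaugeAct_one' U

/-- `g • (g⁻¹ • U) = U`. [folklore] -/
theorem gaugeAct_gaugeAct_inv (g : FinTorusSite n₀ n₁ n₂ n₃ → G) (U : FinTorusSite n₀ n₁ n₂ n₃ × Fin 4 → G) :
    gaugeAct g (gaugeAct g⁻¹ U) = U := by
  rw [← gaugeAct_mul, mul_inv_cancel]; exact gaugeAct_one' U

/-- **Plaquette holonomies transform by conjugation at the base point**: `P_{g•U}(x; μ, ν) = g(x) · P_U(x; μ, ν) · g(x)⁻¹`. [folklore] -/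
theorem finTorusPlaquette_gaugeAct (g : FinTorusSite n₀ n₁ n₂ n₃ → G) (U : FinTorusSite n₀ n₁ n₂ n₃ × Fin 4 → G)
    (x : FinTorusSite n₀ n₁ n₂ n₃) (μ ν : Fin 4) :
    finTorusPlaquette (gaugeAct g U) x μ ν = g x * finTorusPlaquette U x μ ν * (g x)⁻¹ := by
  simp only [finTorusPlaquette, gaugeAct, FinTorusSite.shift_comm x ν μ, mul_inv_rev, inv_inv]
  group

/-- A central twist factor commutes with the conjugation: `w · P_{g•U} = g(x) · (w · P_U) · g(x)⁻¹`. [folklore] -/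
theorem twist_mul_finTorusPlaquette_gaugeAct {w : Fin 4 → Fin 4 → G} (hw : ∀ μ ν, w μ ν ∈ Subgroup.center G)
    (g : FinTorusSite n₀ n₁ n₂ n₃ → G) (U : FinTorusSite n₀ n₁ n₂ n₃ × Fin 4 → G) (x : FinTorusSite n₀ n₁ n₂ n₃) (μ ν : Fin 4) :
    tHooftTwistTensor w x μ ν * finTorusPlaquette (gaugeAct g U) x μ ν =
      g x * (tHooftTwistTensor w x μ ν * finTorusPlaquette U x μ ν) * (g x)⁻¹ := by
  rw [finTorusPlaquette_gaugeAct]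
  have hc := Subgroup.mem_center_iff.mp (tHooftTwistTensor_mem_center hw x μ ν) (g x)
  calc tHooftTwistTensor w x μ ν * (g x * finTorusPlaquette U x μ ν * (g x)⁻¹)
      = (tHooftTwistTensor w x μ ν * g x) * finTorusPlaquette U x μ ν * (g x)⁻¹ := by group
    _ = (g x * tHooftTwistTensor w x μ ν) * finTorusPlaquette U x μ ν * (g x)⁻¹ := by rw [hc]
    _ = g x * (tHooftTwistTensor w x μ ν * finTorusPlaquette U x μ ν) * (g x)⁻¹ := by group

/-- **Twisted-flatness is gauge invariant** (centre-valued 't Hooft tensor). [folklore] -/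
theorem twistedFlat_gaugeAct_iff {w : Fin 4 → Fin 4 → G} (hw : ∀ μ ν, w μ ν ∈ Subgroup.center G)
    (g : FinTorusSite n₀ n₁ n₂ n₃ → G) (U : FinTorusSite n₀ n₁ n₂ n₃ × Fin 4 → G) :
    (∀ (x : FinTorusSite n₀ n₁ n₂ n₃) (μ ν : Fin 4), μ < ν →
        tHooftTwistTensor w x μ ν * finTorusPlaquette (gaugeAct g U) x μ ν = 1) ↔
      ∀ (x : FinTorusSite n₀ n₁ n₂ n₃) (μ ν : Fin 4), μ < ν → tHooftTwistTensor w x μ ν * finTorusPlaquette U x μ ν = 1 := by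
  refine forall₄_congr fun x μ ν _ => ?_
  rw [twist_mul_finTorusPlaquette_gaugeAct hw, mul_inv_eq_one, mul_eq_left]

/-- **The twisted plaquette trace is gauge invariant** (centre-valued tensor, any matrix representation): the integrand of
`wilsonFinTorusPlaqTwistedPartition ρ β _ (tHooftTwistTensor w)` is a class function of the plaquettes. [folklore] -/
theorem trace_twist_mul_finTorusPlaquette_gaugeAct {N : ℕ} (ρ : G →* Matrix (Fin N) (Fin N) ℂ) {w : Fin 4 → Fin 4 → G}
    (hw : ∀ μ ν, w μ ν ∈ Subgroup.center G) (g : FinTorusSite n₀ n₁ n₂ n₃ → G) (U : FinTorusSite n₀ n₁ n₂ n₃ × Fin 4 → G)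
    (x : FinTorusSite n₀ n₁ n₂ n₃) (μ ν : Fin 4) :
    (ρ (tHooftTwistTensor w x μ ν * finTorusPlaquette (gaugeAct g U) x μ ν)).trace =
      (ρ (tHooftTwistTensor w x μ ν * finTorusPlaquette U x μ ν)).trace := by
  rw [twist_mul_finTorusPlaquette_gaugeAct hw, map_mul, map_mul, Matrix.trace_mul_cycle, ← map_mul, inv_mul_cancel, map_one, one_mul]

/-! ## §3 Ladder configurations -/

/-- **The ladder configuration of a quadruple `Γ : Fin 4 → G`**: the link `(x, μ)` carries `Γ μ` if `x_μ = 0` (the sheet of `μ`-links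
leaving the hyperplane `x_μ = 0`) and `1` otherwise — 't Hooft's twist-eating transition functions written as a lattice gauge field
(`eaterConfig` of `TwistedBoundaryConditions` in the `Fin`-box convention where the twist sits on the stack `x_μ = x_ν = 0`). [folklore] -/
def ladderConfig (Γ : Fin 4 → G) : FinTorusSite n₀ n₁ n₂ n₃ × Fin 4 → G :=
  fun e => if finTorusSiteCoord e.1 e.2 = 0 then Γ e.2 else 1

/-- Unfolding lemma. [folklore] -/
theorem ladderConfig_apply (Γ : Fin 4 → G) (x : FinTorusSite n₀ n₁ n₂ n₃) (μ : Fin 4) :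
    ladderConfig Γ (x, μ) = if finTorusSiteCoord x μ = 0 then Γ μ else 1 := rfl

/-- **Plaquettes of a ladder**: the commutator `Γ_μ Γ_ν Γ_μ⁻¹ Γ_ν⁻¹` on the stack `x_μ = x_ν = 0`, trivial elsewhere (`μ ≠ ν`). [folklore] -/
theorem finTorusPlaquette_ladderConfig (Γ : Fin 4 → G) (x : FinTorusSite n₀ n₁ n₂ n₃) {μ ν : Fin 4} (hμν : μ ≠ ν) :
    finTorusPlaquette (ladderConfig Γ) x μ ν =
      if finTorusSiteCoord x μ = 0 ∧ finTorusSiteCoord x ν = 0 then Γ μ * Γ ν * (Γ μ)⁻¹ * (Γ ν)⁻¹ else 1 := by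
  simp only [finTorusPlaquette, ladderConfig_apply, finTorusSiteCoord_shift_of_ne x hμν.symm,
    finTorusSiteCoord_shift_of_ne x hμν]
  by_cases hμ : finTorusSiteCoord x μ = 0 <;> by_cases hν : finTorusSiteCoord x ν = 0 <;> simp [hμ, hν]

/-- **A ladder is twisted-flat iff its quadruple eats the twist**: on a box with all sides `≥ 1`,
`tHooftTwistTensor w · P_{ladder Γ} ≡ 1` iff `w μ ν · Γ_μ Γ_ν Γ_μ⁻¹ Γ_ν⁻¹ = 1` for all `μ < ν`. [folklore] -/
theorem ladderConfig_twistedFlat_iff {m₀ m₁ m₂ m₃ : ℕ} (w : Fin 4 → Fin 4 → G) (Γ : Fin 4 → G) :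
    (∀ (x : FinTorusSite (m₀ + 1) (m₁ + 1) (m₂ + 1) (m₃ + 1)) (μ ν : Fin 4), μ < ν →
        tHooftTwistTensor w x μ ν * finTorusPlaquette (ladderConfig Γ) x μ ν = 1) ↔
      ∀ μ ν : Fin 4, μ < ν → w μ ν * (Γ μ * Γ ν * (Γ μ)⁻¹ * (Γ ν)⁻¹) = 1 := by
  constructor
  · intro h μ ν hμν
    have h0 := h ((0 : Fin (m₀ + 1)), (0 : Fin (m₁ + 1)), (0 : Fin (m₂ + 1)), (0 : Fin (m₃ + 1))) μ ν hμν
    have hc : ∀ τ : Fin 4, finTorusSiteCoord (((0 : Fin (m₀ + 1)), (0 : Fin (m₁ + 1)), (0 : Fin (m₂ + 1)), (0 : Fin (m₃ + 1))) :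
        FinTorusSite (m₀ + 1) (m₁ + 1) (m₂ + 1) (m₃ + 1)) τ = 0 := fun τ => by
      fin_cases τ <;> rfl
    rwa [finTorusPlaquette_ladderConfig Γ _ hμν.ne, tHooftTwistTensor, if_pos ⟨hc μ, hc ν⟩, if_pos ⟨hc μ, hc ν⟩] at h0
  · intro h x μ ν hμν
    rw [finTorusPlaquette_ladderConfig Γ _ hμν.ne, tHooftTwistTensor]
    by_cases hx : finTorusSiteCoord x μ = 0 ∧ finTorusSiteCoord x ν = 0
    · rw [if_pos hx, if_pos hx]; exact h μ ν hμν
    · rw [if_neg hx, if_neg hx, mul_one]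

/-- **Constant gauge maps conjugate ladders**: `(const h) • ladder Γ = ladder (h Γ h⁻¹)`. [folklore] -/
theorem gaugeAct_const_ladderConfig (h : G) (Γ : Fin 4 → G) :
    gaugeAct (fun _ : FinTorusSite n₀ n₁ n₂ n₃ => h) (ladderConfig Γ) = ladderConfig fun μ => h * Γ μ * h⁻¹ := by
  funext e
  obtain ⟨x, μ⟩ := e
  simp only [gaugeAct, ladderConfig_apply]
  split_ifs <;> simp

/-! ## §4 Natural-number coordinates on a box with all sides `≥ 1`, and the sheet-adapted axial gauge map -/

section NatCoords

open Fin.NatCast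

variable {m₀ m₁ m₂ m₃ : ℕ}

/-- The site with natural-number coordinates `(i, j, k, l)` (read modulo the sides). [folklore] -/
def natSite (m₀ m₁ m₂ m₃ : ℕ) (i j k l : ℕ) : FinTorusSite (m₀ + 1) (m₁ + 1) (m₂ + 1) (m₃ + 1) :=
  ((i : Fin (m₀ + 1)), (j : Fin (m₁ + 1)), (k : Fin (m₂ + 1)), (l : Fin (m₃ + 1)))

/-- Coordinates of `natSite`. [folklore] -/
theorem finTorusSiteCoord_natSite (i j k l : ℕ) :
    finTorusSiteCoord (natSite m₀ m₁ m₂ m₃ i j k l) = ![i % (m₀ + 1), j % (m₁ + 1), k % (m₂ + 1), l % (m₃ + 1)] := by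
  unfold finTorusSiteCoord natSite
  simp

/-- The four shifts of `natSite`: `+1` on the shifted coordinate. [folklore] -/
theorem natSite_shift (i j k l : ℕ) :
    (natSite m₀ m₁ m₂ m₃ i j k l).shift 0 = natSite m₀ m₁ m₂ m₃ (i + 1) j k l ∧
    (natSite m₀ m₁ m₂ m₃ i j k l).shift 1 = natSite m₀ m₁ m₂ m₃ i (j + 1) k l ∧
    (natSite m₀ m₁ m₂ m₃ i j k l).shift 2 = natSite m₀ m₁ m₂ m₃ i j (k + 1) l ∧
    (natSite m₀ m₁ m₂ m₃ i j k l).shift 3 = natSite m₀ m₁ m₂ m₃ i j k (l + 1) := by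
  refine ⟨?_, ?_, ?_, ?_⟩ <;>
    simp [natSite, FinTorusSite.shift, finRotate_apply, Nat.cast_succ]

/-- **The representative in `[1, m+1]`** of a residue `a : Fin (m+1)`: `a` itself if `a ≠ 0`, and `m + 1` for `a = 0` — coordinates are
read from `1` so that the sheet `x_μ = 0` is the LAST hyperplane reached along the axial path. [folklore] -/
def finRep {m : ℕ} (a : Fin (m + 1)) : ℕ := if (a : ℕ) = 0 then m + 1 else a

/-- `finRep a` casts back to `a`. [folklore] -/
theorem natCast_finRep {m : ℕ} (a : Fin (m + 1)) : ((finRep a : ℕ) : Fin (m + 1)) = a := by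
  unfold finRep
  split_ifs with h
  · rw [Fin.natCast_self]; exact Fin.ext (by simpa using h.symm)
  · exact Fin.cast_val_eq_self a

/-- `1 ≤ finRep a`. [folklore] -/
theorem one_le_finRep {m : ℕ} (a : Fin (m + 1)) : 1 ≤ finRep a := by
  unfold finRep; split_ifs with h <;> omega

/-- `finRep a ≤ m + 1`. [folklore] -/
theorem finRep_le {m : ℕ} (a : Fin (m + 1)) : finRep a ≤ m + 1 := by
  unfold finRep; split_ifs with h <;> omega

/-- Off the sheet, `finRep a = a ≤ m`. [folklore] -/
theorem finRep_of_ne_zero {m : ℕ} {a : Fin (m + 1)} (h : (a : ℕ) ≠ 0) : finRep a = a ∧ finRep a ≤ m := by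
  unfold finRep; rw [if_neg h]; exact ⟨rfl, by omega⟩

/-- Off the sheet, the shift adds one to the representative: `finRep (a + 1) = finRep a + 1` for `a ≠ 0`. [folklore] -/
theorem finRep_finRotate_of_ne_zero {m : ℕ} {a : Fin (m + 1)} (h : (a : ℕ) ≠ 0) :
    finRep (finRotate (m + 1) a) = finRep a + 1 := by
  rw [(finRep_of_ne_zero h).1]
  unfold finRep
  rw [finRotate_apply, Fin.val_add_one]
  by_cases hl : a = Fin.last m
  · simp [hl]
  · simp [hl]

/-- Every site is `natSite` of its representatives. [folklore] -/
theorem natSite_finRep (a : Fin (m₀ + 1)) (b : Fin (m₁ + 1)) (c : Fin (m₂ + 1)) (d : Fin (m₃ + 1)) :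
    natSite m₀ m₁ m₂ m₃ (finRep a) (finRep b) (finRep c) (finRep d) = (a, b, c, d) := by
  simp only [natSite, natCast_finRep]

/-- **The sheet-adapted axial gauge map** of a configuration `U`, on natural coordinates `(i, j, k, l) ∈ [1, m+1]⁴`: the holonomy of `U`
along the staircase from the base site `(1,1,1,1)` — `i − 1` steps in direction `0`, then `j − 1` in direction `1`, `k − 1` in direction `2`,
`l − 1` in direction `3` — which never crosses a sheet `x_μ = 0 → 1` (Creutz's complete axial gauge on the maximal tree complementary to
the sheets). [folklore] -/
def axialGaugeNat (U : FinTorusSite (m₀ + 1) (m₁ + 1) (m₂ + 1) (m₃ + 1) × Fin 4 → G) (i j k l : ℕ) : G :=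
  lprod (fun s => U (natSite m₀ m₁ m₂ m₃ (s + 1) 1 1 1, 0)) (i - 1) *
    lprod (fun s => U (natSite m₀ m₁ m₂ m₃ i (s + 1) 1 1, 1)) (j - 1) *
    lprod (fun s => U (natSite m₀ m₁ m₂ m₃ i j (s + 1) 1, 2)) (k - 1) *
    lprod (fun s => U (natSite m₀ m₁ m₂ m₃ i j k (s + 1), 3)) (l - 1)

/-- **The sheet-adapted axial gauge map** as a site function (coordinates read through `finRep`). [folklore] -/
def axialGauge (U : FinTorusSite (m₀ + 1) (m₁ + 1) (m₂ + 1) (m₃ + 1) × Fin 4 → G)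
    (x : FinTorusSite (m₀ + 1) (m₁ + 1) (m₂ + 1) (m₃ + 1)) : G :=
  axialGaugeNat U (finRep x.1) (finRep x.2.1) (finRep x.2.2.1) (finRep x.2.2.2)

/-- Unfolding lemma. [folklore] -/
theorem axialGauge_apply (U : FinTorusSite (m₀ + 1) (m₁ + 1) (m₂ + 1) (m₃ + 1) × Fin 4 → G)
    (x : FinTorusSite (m₀ + 1) (m₁ + 1) (m₂ + 1) (m₃ + 1)) :
    axialGauge U x = axialGaugeNat U (finRep x.1) (finRep x.2.1) (finRep x.2.2.1) (finRep x.2.2.2) := rfl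

end NatCoords

end Summit.QuantumFields.YangMills.Cruxes.IRcof.TwistedSlab
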